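/-
Copyright: the b2b-balaban T⁴-continuum CRUX team, row NE7b OWNER lineage `t4-ne7b-p1` (gen 106). Project licence.
-/
import Summits.QuantumFields.BalabanUV.T4Continuum.Spine.NE7b.StabilityWindowSandwich
import Summits.QuantumFields.BalabanUV.T4Continuum.Spine.NE7b.CarrierOnSupport

/-!
# `LocCondStability` BY NAME for PERTURBED coupled-block Gaussian one-step kernels: the carrier
# `M = (∫ F₁ᴺF₂·e^{Q}·e^{−S−V}) ∕ (∫ F₁ᴰF₂·e^{−S−V})` inhabits the road's named `Prop` with `b = v⁻ + v⁺ + b_G`, from data displayed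
# ON THE SUPPORT OF THE TERM (row NE7b, node U5c; kernel junction)

Cell `pub-balaban`, sub-cell `t4`, spine estimate NE7b (`T4WeightBudget.RelWeightBound`; the cell's OWN estimate — NOT PRINTED in
[Bałaban 1983–89], NOT PROVED).  Crux-route work under `Spine/NE7b/` by the row's OWNER; NOTHING of Bałaban's is named or asserted;
no `T4Continuum/Support` leaf typed; no `def`; zero `sorry`.

WHY.  The Gaussian share (`…CarrierOnSupport.locCondStability_of_gaussianCarrier_on_support`, gen 105) inhabits the road's ONE residual
`Prop` of Bałaban's kind, `…LocalConditionalStability.LocCondStability`, for carriers that are normalised GAUSSIAN moments of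
background-dependent data.  With `…LocalPerturbationSandwich` ∕ `…StabilityWindowSandwich` (gen 106) the kernel share covers the KIND
of print's one-step densities — `characteristic functions × e^{−(quadratic form) − (non-quadratic remainder)}` in the fresh variables,
near ∕ far blocks coupled — and THIS FILE is the junction BY NAME: at every pattern prefix `g` of a level `j < K` and every background
`y`, let the carrier be the perturbed conditional moment
`M j g y = (∫ F₁ᴺF₂·e^{xᵀ(Q₁⊕0)x}·e^{−xᵀSx}·e^{−(V₁+V₂)}) ∕ (∫ F₁ᴰF₂·e^{−xᵀSx}·e^{−(V₁+V₂)})` of data depending on `(j, g, y)` (block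
index types depending on `(j, g)`: the pinned region's neighbourhood); if ON THE SUPPORT OF THE TERM (`eterm j g y ≠ 0`; nothing is
asked of the large-field backgrounds the history excluded) the hypotheses of `…StabilityWindowSandwich.perturbedMoment_le_of_stability_window`
hold with `y`-UNIFORM exponents — stability `v⁻ j g`, smallness `v⁺ j g` on a window, and the unperturbed fibre constant `e^{b_G j g}` —
then `LocCondStability T S K μ ρ₀ M (v⁻ + v⁺ + b_G)` (integrability conjunct included, via `…CarrierOnSupport`).

WHAT IS PROVED ([folklore]; plumbing over the gen-105∕106 theorems): `perturbedCarrier_nonneg`, `perturbedCarrier_le`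
(`0 ≤ M ≤ e^{v⁻+v⁺+b_G}` per background from the displayed data), **`locCondStability_of_perturbedCarrier_on_support`**.

NOT HERE (honest): the data for Bałaban's steps ((A3) identification; (R1″) induced-mean energies behind `b_G`; (R2′) the sup bounds
behind `v^∓`); anything of Bałaban's.  NE7b NOT PRINTED ∕ NOT PROVED; spine PROVED 0∕9; rung (B)+1 on a FINITE torus — NOT infinite
volume, NOT the mass gap, NOT Clay.
HONEST DEPENDENCY: continuum YM on T⁴ ⇐ BetaPertH ∧ nine spine estimates (0/9 proved); BetaPertH ⇐ (D1) ∧ (D4) ∧ CAP+tail.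
-/

set_option autoImplicit false

open Matrix Finset MeasureTheory Real
open Summit.QuantumFields.BalabanUV.T4Continuum.B16HistoryIndexedRepr Summit.QuantumFields.BalabanUV.T4Continuum.B16HistoryReprChain
open Summit.QuantumFields.BalabanUV.T4Continuum.NE7b.PrefixExtraction Summit.QuantumFields.BalabanUV.T4Continuum.NE7b.LocalConditionalStability
open Summit.QuantumFields.BalabanUV.T4Continuum.NE7b.CarrierOnSupport
open Summit.QuantumFields.BalabanUV.T4Continuum.NE7b.LocalPerturbationSandwich
open Summit.QuantumFields.BalabanUV.T4Continuum.NE7b.StabilityWindowSandwich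

namespace Summit.QuantumFields.BalabanUV.T4Continuum.NE7b.PerturbedCarrierLCS

/-! ## §1 The perturbed carrier of one background: non-negative, and bounded from the displayed data -/

section OneBackground

variable {n₁ n₂ : Type} [Fintype n₁] [Fintype n₂]

/-- The perturbed conditional moment is non-negative (non-negative restrictions; Lean's `x ∕ 0 = 0`). [folklore] -/
theorem perturbedCarrier_nonneg (S₁₁ Q₁ : Matrix n₁ n₁ ℝ) (S₁₂ : Matrix n₁ n₂ ℝ) (S₂₂ : Matrix n₂ n₂ ℝ)
    (F₁ D₁ : (n₁ → ℝ) → ℝ) (F₂ : (n₂ → ℝ) → ℝ) (V₁ : (n₁ ⊕ n₂ → ℝ) → ℝ) (V₂ : (n₂ → ℝ) → ℝ)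
    (hF₁ : ∀ x₁, 0 ≤ F₁ x₁) (hD₁ : ∀ x₁, 0 ≤ D₁ x₁) (hF₂ : ∀ x₂, 0 ≤ F₂ x₂) :
    0 ≤ (∫ x : n₁ ⊕ n₂ → ℝ, (F₁ (fun i => x (Sum.inl i)) * F₂ (fun i => x (Sum.inr i))) *
        ((exp (x ⬝ᵥ (Matrix.fromBlocks Q₁ 0 0 (0 : Matrix n₂ n₂ ℝ) *ᵥ x)) *
          exp (-(x ⬝ᵥ (Matrix.fromBlocks S₁₁ S₁₂ S₁₂ᵀ S₂₂ *ᵥ x)))) * exp (-(V₁ x + V₂ (fun i => x (Sum.inr i)))))) /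
      (∫ x : n₁ ⊕ n₂ → ℝ, (D₁ (fun i => x (Sum.inl i)) * F₂ (fun i => x (Sum.inr i))) *
        (exp (-(x ⬝ᵥ (Matrix.fromBlocks S₁₁ S₁₂ S₁₂ᵀ S₂₂ *ᵥ x))) * exp (-(V₁ x + V₂ (fun i => x (Sum.inr i)))))) :=
  div_nonneg
    (integral_nonneg fun _ => mul_nonneg (mul_nonneg (hF₁ _) (hF₂ _))
      (mul_nonneg (mul_nonneg (exp_pos _).le (exp_pos _).le) (exp_pos _).le))
    (integral_nonneg fun _ => mul_nonneg (mul_nonneg (hD₁ _) (hF₂ _)) (mul_nonneg (exp_pos _).le (exp_pos _).le))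

/-- **THE PERTURBED CARRIER OF ONE BACKGROUND IS AT MOST `e^{v⁻ + v⁺ + b_G}`** under the hypotheses of
`…StabilityWindowSandwich.perturbedMoment_le_of_stability_window` with the unperturbed fibre constant `e^{b_G}`. [folklore] -/
theorem perturbedCarrier_le (S₁₁ Q₁ : Matrix n₁ n₁ ℝ) (S₁₂ : Matrix n₁ n₂ ℝ) (S₂₂ : Matrix n₂ n₂ ℝ)
    (F₁ D₁ G₁ : (n₁ → ℝ) → ℝ) (F₂ : (n₂ → ℝ) → ℝ) (V₁ : (n₁ ⊕ n₂ → ℝ) → ℝ) (V₂ : (n₂ → ℝ) → ℝ) {bG vm vp : ℝ}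
    (hF₁ : ∀ x₁, 0 ≤ F₁ x₁) (hD₁ : ∀ x₁, 0 ≤ D₁ x₁) (hG₁ : ∀ x₁, 0 ≤ G₁ x₁) (hGD : ∀ x₁, G₁ x₁ ≤ D₁ x₁)
    (hF₂ : ∀ x₂, 0 ≤ F₂ x₂)
    (hstab : ∀ x : n₁ ⊕ n₂ → ℝ, F₁ (fun i => x (Sum.inl i)) ≠ 0 → F₂ (fun i => x (Sum.inr i)) ≠ 0 → -vm ≤ V₁ x)
    (hsmall : ∀ x : n₁ ⊕ n₂ → ℝ, G₁ (fun i => x (Sum.inl i)) ≠ 0 → F₂ (fun i => x (Sum.inr i)) ≠ 0 → V₁ x ≤ vp)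
    (hA : Integrable fun x : n₁ ⊕ n₂ → ℝ =>
      (F₁ (fun i => x (Sum.inl i)) * (F₂ (fun i => x (Sum.inr i)) * exp (-V₂ (fun i => x (Sum.inr i))))) *
        (exp (x ⬝ᵥ (Matrix.fromBlocks Q₁ 0 0 (0 : Matrix n₂ n₂ ℝ) *ᵥ x)) *
          exp (-(x ⬝ᵥ (Matrix.fromBlocks S₁₁ S₁₂ S₁₂ᵀ S₂₂ *ᵥ x)))))
    (hW : Integrable fun x : n₁ ⊕ n₂ → ℝ =>
      (G₁ (fun i => x (Sum.inl i)) * (F₂ (fun i => x (Sum.inr i)) * exp (-V₂ (fun i => x (Sum.inr i))))) *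
        exp (-(x ⬝ᵥ (Matrix.fromBlocks S₁₁ S₁₂ S₁₂ᵀ S₂₂ *ᵥ x))))
    (hB' : Integrable fun x : n₁ ⊕ n₂ → ℝ => (D₁ (fun i => x (Sum.inl i)) * F₂ (fun i => x (Sum.inr i))) *
      (exp (-(x ⬝ᵥ (Matrix.fromBlocks S₁₁ S₁₂ S₁₂ᵀ S₂₂ *ᵥ x))) * exp (-(V₁ x + V₂ (fun i => x (Sum.inr i))))))
    (hfib : ∀ x₂, F₂ x₂ ≠ 0 →
      ∫ x₁, F₁ x₁ * (exp (x₁ ⬝ᵥ (Q₁ *ᵥ x₁)) * exp (-(x₁ ⬝ᵥ (S₁₁ *ᵥ x₁) + 2 * (x₁ ⬝ᵥ (S₁₂ *ᵥ x₂))))) ≤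
        exp bG * ∫ x₁, G₁ x₁ * exp (-(x₁ ⬝ᵥ (S₁₁ *ᵥ x₁) + 2 * (x₁ ⬝ᵥ (S₁₂ *ᵥ x₂))))) :
    (∫ x : n₁ ⊕ n₂ → ℝ, (F₁ (fun i => x (Sum.inl i)) * F₂ (fun i => x (Sum.inr i))) *
        ((exp (x ⬝ᵥ (Matrix.fromBlocks Q₁ 0 0 (0 : Matrix n₂ n₂ ℝ) *ᵥ x)) *
          exp (-(x ⬝ᵥ (Matrix.fromBlocks S₁₁ S₁₂ S₁₂ᵀ S₂₂ *ᵥ x)))) * exp (-(V₁ x + V₂ (fun i => x (Sum.inr i)))))) /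
      (∫ x : n₁ ⊕ n₂ → ℝ, (D₁ (fun i => x (Sum.inl i)) * F₂ (fun i => x (Sum.inr i))) *
        (exp (-(x ⬝ᵥ (Matrix.fromBlocks S₁₁ S₁₂ S₁₂ᵀ S₂₂ *ᵥ x))) * exp (-(V₁ x + V₂ (fun i => x (Sum.inr i)))))) ≤
      exp (vm + vp + bG) := by
  refine div_le_of_le_mul (exp_pos _).le
    (integral_nonneg fun _ => mul_nonneg (mul_nonneg (hD₁ _) (hF₂ _)) (mul_nonneg (exp_pos _).le (exp_pos _).le)) ?_
  rw [exp_add]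
  exact perturbedMoment_le_of_stability_window S₁₁ Q₁ S₁₂ S₂₂ F₁ D₁ G₁ F₂ V₁ V₂ hF₁ hG₁ hGD hF₂ (exp_pos _).le
    hstab hsmall hA hW hB' hfib

end OneBackground

/-! ## §2 The junction: `LocCondStability` by name for the perturbed carrier, from data displayed on the support -/

section Junction

variable {P : Type} [DecidableEq P] {C : ℕ → Type} {𝒢 : (j : ℕ) → GoodClass (C j)}

/-- **LCS FOR A BACKGROUND-DEPENDENT PERTURBED COUPLED-BLOCK CARRIER, ON THE SUPPORT.**  At every pattern prefix `g` of a level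
`j < K` and every background `y` let the carrier `M j g y` be the perturbed conditional moment of the data at `(j, g, y)` — near ∕ far
block index types `n₁ j g`, `n₂ j g` (the pinned region's neighbourhood and the rest), forms `S₁₁, S₁₂, S₂₂, Q₁`, restrictions
`F₁ᴺ, F₁ᴰ, G₁, F₂`, perturbation `V₁ + V₂`, all depending on `(j, g, y)` —; suppose `M j g` is a.e.-strongly measurable and that ON THE
SUPPORT OF THE TERM (`eterm j g y ≠ 0`) the hypotheses of `…StabilityWindowSandwich.perturbedMoment_le_of_stability_window` hold with the
`y`-UNIFORM exponents `v⁻ j g` (stability), `v⁺ j g` (smallness on the window) and the unperturbed fibre constant `e^{b_G j g}`.  Then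
`LocCondStability T S K μ ρ₀ M (v⁻ + v⁺ + b_G)`, integrability conjunct included. [folklore] -/
theorem locCondStability_of_perturbedCarrier_on_support (T : Tower P C 𝒢) (Spat : (j : ℕ) → (Fin j → P) → Finset P)
    (K : ℕ) [∀ j, MeasurableSpace (C j)] (μ : (j : ℕ) → Measure (C j)) (ρ₀ : C 0 → ℝ)
    (M : (j : ℕ) → (Fin j → P) → C j → ℝ)
    (n₁ n₂ : (j : ℕ) → (Fin j → P) → Type) [∀ j g, Fintype (n₁ j g)] [∀ j g, Fintype (n₂ j g)]
    (S₁₁ Q₁ : (j : ℕ) → (g : Fin j → P) → C j → Matrix (n₁ j g) (n₁ j g) ℝ)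
    (S₁₂ : (j : ℕ) → (g : Fin j → P) → C j → Matrix (n₁ j g) (n₂ j g) ℝ)
    (S₂₂ : (j : ℕ) → (g : Fin j → P) → C j → Matrix (n₂ j g) (n₂ j g) ℝ)
    (F₁ D₁ G₁ : (j : ℕ) → (g : Fin j → P) → C j → (n₁ j g → ℝ) → ℝ)
    (F₂ : (j : ℕ) → (g : Fin j → P) → C j → (n₂ j g → ℝ) → ℝ)
    (V₁ : (j : ℕ) → (g : Fin j → P) → C j → (n₁ j g ⊕ n₂ j g → ℝ) → ℝ)
    (V₂ : (j : ℕ) → (g : Fin j → P) → C j → (n₂ j g → ℝ) → ℝ)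
    (bG vm vp : (j : ℕ) → (Fin j → P) → ℝ) (hρ : (𝒢 0).Gd ρ₀) (h0 : ∀ x, 0 ≤ ρ₀ x)
    (hM : ∀ j g, j < K → g ∈ admS T Spat j → ∀ y, M j g y =
      (∫ x : n₁ j g ⊕ n₂ j g → ℝ, (F₁ j g y (fun i => x (Sum.inl i)) * F₂ j g y (fun i => x (Sum.inr i))) *
          ((exp (x ⬝ᵥ (Matrix.fromBlocks (Q₁ j g y) 0 0 (0 : Matrix (n₂ j g) (n₂ j g) ℝ) *ᵥ x)) *
            exp (-(x ⬝ᵥ (Matrix.fromBlocks (S₁₁ j g y) (S₁₂ j g y) (S₁₂ j g y)ᵀ (S₂₂ j g y) *ᵥ x)))) *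
            exp (-(V₁ j g y x + V₂ j g y (fun i => x (Sum.inr i)))))) /
        (∫ x : n₁ j g ⊕ n₂ j g → ℝ, (D₁ j g y (fun i => x (Sum.inl i)) * F₂ j g y (fun i => x (Sum.inr i))) *
          (exp (-(x ⬝ᵥ (Matrix.fromBlocks (S₁₁ j g y) (S₁₂ j g y) (S₁₂ j g y)ᵀ (S₂₂ j g y) *ᵥ x))) *
            exp (-(V₁ j g y x + V₂ j g y (fun i => x (Sum.inr i)))))))
    (hMm : ∀ j g, j < K → g ∈ admS T Spat j → AEStronglyMeasurable (M j g) (μ j))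
    (hF₁ : ∀ j g, j < K → g ∈ admS T Spat j → ∀ y x₁, 0 ≤ F₁ j g y x₁)
    (hD₁ : ∀ j g, j < K → g ∈ admS T Spat j → ∀ y x₁, 0 ≤ D₁ j g y x₁)
    (hG₁ : ∀ j g, j < K → g ∈ admS T Spat j → ∀ y x₁, 0 ≤ G₁ j g y x₁)
    (hGD : ∀ j g, j < K → g ∈ admS T Spat j → ∀ y x₁, G₁ j g y x₁ ≤ D₁ j g y x₁)
    (hF₂ : ∀ j g, j < K → g ∈ admS T Spat j → ∀ y x₂, 0 ≤ F₂ j g y x₂)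
    (hstab : ∀ j g, j < K → g ∈ admS T Spat j → ∀ y, T.eterm ρ₀ j g y ≠ 0 → ∀ x : n₁ j g ⊕ n₂ j g → ℝ,
      F₁ j g y (fun i => x (Sum.inl i)) ≠ 0 → F₂ j g y (fun i => x (Sum.inr i)) ≠ 0 → -vm j g ≤ V₁ j g y x)
    (hsmall : ∀ j g, j < K → g ∈ admS T Spat j → ∀ y, T.eterm ρ₀ j g y ≠ 0 → ∀ x : n₁ j g ⊕ n₂ j g → ℝ,
      G₁ j g y (fun i => x (Sum.inl i)) ≠ 0 → F₂ j g y (fun i => x (Sum.inr i)) ≠ 0 → V₁ j g y x ≤ vp j g)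
    (hA : ∀ j g, j < K → g ∈ admS T Spat j → ∀ y, T.eterm ρ₀ j g y ≠ 0 → Integrable fun x : n₁ j g ⊕ n₂ j g → ℝ =>
      (F₁ j g y (fun i => x (Sum.inl i)) * (F₂ j g y (fun i => x (Sum.inr i)) * exp (-V₂ j g y (fun i => x (Sum.inr i))))) *
        (exp (x ⬝ᵥ (Matrix.fromBlocks (Q₁ j g y) 0 0 (0 : Matrix (n₂ j g) (n₂ j g) ℝ) *ᵥ x)) *
          exp (-(x ⬝ᵥ (Matrix.fromBlocks (S₁₁ j g y) (S₁₂ j g y) (S₁₂ j g y)ᵀ (S₂₂ j g y) *ᵥ x)))))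
    (hW : ∀ j g, j < K → g ∈ admS T Spat j → ∀ y, T.eterm ρ₀ j g y ≠ 0 → Integrable fun x : n₁ j g ⊕ n₂ j g → ℝ =>
      (G₁ j g y (fun i => x (Sum.inl i)) * (F₂ j g y (fun i => x (Sum.inr i)) * exp (-V₂ j g y (fun i => x (Sum.inr i))))) *
        exp (-(x ⬝ᵥ (Matrix.fromBlocks (S₁₁ j g y) (S₁₂ j g y) (S₁₂ j g y)ᵀ (S₂₂ j g y) *ᵥ x))))
    (hB' : ∀ j g, j < K → g ∈ admS T Spat j → ∀ y, T.eterm ρ₀ j g y ≠ 0 → Integrable fun x : n₁ j g ⊕ n₂ j g → ℝ =>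
      (D₁ j g y (fun i => x (Sum.inl i)) * F₂ j g y (fun i => x (Sum.inr i))) *
        (exp (-(x ⬝ᵥ (Matrix.fromBlocks (S₁₁ j g y) (S₁₂ j g y) (S₁₂ j g y)ᵀ (S₂₂ j g y) *ᵥ x))) *
          exp (-(V₁ j g y x + V₂ j g y (fun i => x (Sum.inr i))))))
    (hfib : ∀ j g, j < K → g ∈ admS T Spat j → ∀ y, T.eterm ρ₀ j g y ≠ 0 → ∀ x₂, F₂ j g y x₂ ≠ 0 →
      ∫ x₁, F₁ j g y x₁ * (exp (x₁ ⬝ᵥ (Q₁ j g y *ᵥ x₁)) *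
          exp (-(x₁ ⬝ᵥ (S₁₁ j g y *ᵥ x₁) + 2 * (x₁ ⬝ᵥ (S₁₂ j g y *ᵥ x₂))))) ≤
        exp (bG j g) * ∫ x₁, G₁ j g y x₁ * exp (-(x₁ ⬝ᵥ (S₁₁ j g y *ᵥ x₁) + 2 * (x₁ ⬝ᵥ (S₁₂ j g y *ᵥ x₂)))))
    (hint : ∀ j g, j < K → g ∈ admS T Spat j → Integrable (T.eterm ρ₀ j g) (μ j)) :
    LocCondStability T Spat K μ ρ₀ M (fun j g => vm j g + vp j g + bG j g) := by
  refine locCondStability_of_carrier_le_on_support T Spat K μ ρ₀ M _ hρ h0 hMm (fun j g hj hg y => ?_)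
    (fun j g hj hg y hy => ?_) hint
  · rw [hM j g hj hg y]
    exact perturbedCarrier_nonneg _ _ _ _ _ _ _ _ _ (hF₁ j g hj hg y) (hD₁ j g hj hg y) (hF₂ j g hj hg y)
  · rw [hM j g hj hg y]
    exact perturbedCarrier_le _ _ _ _ _ _ _ _ _ _ (hF₁ j g hj hg y) (hD₁ j g hj hg y) (hG₁ j g hj hg y) (hGD j g hj hg y)
      (hF₂ j g hj hg y) (hstab j g hj hg y hy) (hsmall j g hj hg y hy) (hA j g hj hg y hy) (hW j g hj hg y hy)
      (hB' j g hj hg y hy) (hfib j g hj hg y hy)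

end Junction

end Summit.QuantumFields.BalabanUV.T4Continuum.NE7b.PerturbedCarrierLCS
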